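import Mathlib.AlgebraicTopology.FundamentalGroupoid.FundamentalGroup
import Mathlib.GroupTheory.Abelianization.Defs
import Mathlib.Geometry.Manifold.Instances.Sphere
import Mathlib.Topology.Path
import Literature.Topology.FourManifolds.Knots
import Literature.Topology.FourManifolds.DehnSurgery
import HarnessLib

-- provenance: harness21/H21/H21/Prelude/FourManL/LinkingNumber.lean @ 5e204f8 (interim HEAD d8f2665); M5 mechanical rewrite
/-!
# Linking numbers of disjoint knots in `S³` (trunk T-4MAN, prelude `FourManL`, outline C5)

This prelude file of the H21 library (trunk `FourManL`; notions `kirby_calculus_handles` (b),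
`knot_link_S3`; outline `H21/Outlines/FourManL.md` §C5) formalises the **linking number**
`lk(K, J) ∈ ℤ` of two disjoint oriented knots `K J : 𝕊 1 → 𝕊 3`, following exactly the pattern
of the framing predicate `Literature.Topology.FourManifolds.Knot.TubularNbhd.HasFraming` of the accepted file
`Literature.Prelude.FourManM.DehnSurgery`: `lk(K, J) = l` iff the class of the loop `J` in
`H₁(S³ ∖ K; ℤ) = π₁(S³ ∖ K)ᵃᵇ ≅ ℤ` is `l` times the class of the (oriented) meridian of `K`
(Rolfsen, *Knots and Links* (1976), §5.D, characterisation (2) of the linking number).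

* `Literature.Knot.loopInCompl K J h`: the knot `J`, disjoint from `K`, as a loop
  `θ ↦ J (e^{2πiθ})` in the knot complement `K.complement` (an `Opens (𝕊 3)`), based at
  `J (circlePoint 0)`.
* `Literature.Knot.HasLinkingNumber K J h l`: **`lk(K, J) = l`**: for some oriented tubular
  neighbourhood `ν` of `K` and some path `γ` from its base point `ν.basePoint` to
  `J (circlePoint 0)`, the class of `γ · J · γ⁻¹` in `π₁(S³ ∖ K, ν.basePoint)ᵃᵇ` is the `l`-th
  power of the class of the meridian `ν.meridian` (whose orientation is fixed by `det_pos`).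
  The conjugating path `γ` is irrelevant in the abelianisation, and the class of the meridian
  does not depend on `ν` (`hasLinkingNumber_iff_forall`).
* `Literature.Knot.TubularNbhd.pushOff ν : Knot`: the push-off (longitude, framing curve)
  `x ↦ ν (x, e₀)` of `K` along `ν`, a knot disjoint from `K` (`disjoint_range_pushOff`);
  `hasFraming_iff_hasLinkingNumber_pushOff`: the framing of `ν` is the linking number of `K`
  with the push-off (proved, taking the independence fact `hasLinkingNumber_iff_forall` as an
  explicit hypothesis).

## Main statements (named facts `def … : Prop`, D-0014; known results; Rolfsen (1976), §5.D)

* `Literature.Topology.FourManifolds.Knot.existsUnique_hasLinkingNumber`: the linking number is well defined;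
  `Literature.Topology.FourManifolds.Knot.hasLinkingNumber_iff_forall`: it does not depend on `ν`, `γ`;
* `Literature.Topology.FourManifolds.Knot.HasLinkingNumber.symm`: `lk(K, J) = lk(J, K)`;
  `Literature.Topology.FourManifolds.Knot.HasLinkingNumber.reverse_right`: `lk(K, rJ) = -lk(K, J)`;
  `Literature.Topology.FourManifolds.Knot.HasLinkingNumber.mirror`: `lk(K̄, J̄) = -lk(K, J)`;
* `Literature.Topology.FourManifolds.Knot.hasLinkingNumber_zero_of_exists_disc`: if `J` bounds a (singular) disc missing `K`
  then `lk(K, J) = 0`.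

`Literature/` is `sorry`-free (D-0014): these unproved results are `def … : Prop` carrying their
statements. The smoothness of the push-off (`Literature.Topology.FourManifolds.Knot.TubularNbhd.isSmoothEmbedding_pushOff`,
which needs `Manifold.IsSmoothEmbedding.comp`, a Mathlib TODO) is a named fact consumed by the
construction `pushOff` as the one-field `Prop`-valued class
`[Literature.Knot.TubularNbhd.SmoothnessFacts]`, exactly as `Knots` does for `mirror`/`reverse` with
`[Literature.SphereEmbedding.SmoothnessFacts]`; the reverse/mirror lemmas of this file carry the latter
instance hypothesis (under which `Knot.reverse`, `Knot.mirror` exist).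

## Downstream note (M5 migration)

`KirbyMoves` uses `ν.pushOff` (in `FramedLink.IsHandleSlide`) and `Knot.range_reverse`,
`Knot.disjoint_range_mirror`: those declarations must now carry
`[Knot.TubularNbhd.SmoothnessFacts]` resp. `[SphereEmbedding.SmoothnessFacts]`.

## Sources

* D. Rolfsen, *Knots and Links*, Publish or Perish (1976), §5.D (eight equivalent definitions
  of the linking number; Thm 5.D.1, 5.D.2), §3.C (mirror, reverse), §9.F (longitudes, framings).
* R. Gompf, A. Stipsicz, *4-Manifolds and Kirby Calculus* (1999), §4.5 (framings as linking
  numbers of push-offs), §5.1.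

## Mathlib status and design choices

* Mathlib has `FundamentalGroup`, `FundamentalGroup.fromPath`, `Path.Homotopic.Quotient`,
  `Abelianization`, `Path.trans/symm/refl` and their homotopy laws
  (`Path.Homotopic.refl_trans`, `trans_refl`), but **no** linking numbers, knot complements'
  homology or degree theory (`rg -i 'linking number|linkingNumber' Mathlib`: nothing). The
  definition is therefore via `π₁ᵃᵇ` of `K.complement`, as G18's `HasFraming`.
* All loops live in `↥K.complement` (G18's `SphereEmbedding.complement : Opens (𝕊 3)`), where
  `ν.basePoint`, `ν.meridian`, `ν.longitude` live, so that `Path.trans` with `ν.meridian`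
  typechecks (outline review #3).
* Sign conventions: the meridian is oriented by G18's `det_pos`; both `HasFraming` and
  `HasLinkingNumber` use the same meridian, so `hasFraming_iff_hasLinkingNumber_pushOff` is
  convention-free. If the opposite global convention is preferred only `l ↦ -l` changes.
* `hasLinkingNumber_zero_of_exists_disc` is stated for a continuous (singular) disc
  `D² → S³ ∖ K` bounded by `J`, which contains the smoothly embedded case of the outline and is
  still Rolfsen §5.D (a loop null-homotopic in `S³ ∖ K` is null-homologous there).
-/

open scoped Manifold ContDiff Topology
open Function Set

noncomputable section

namespace Literature.Topology.FourManifolds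

/-- Local notation: `𝔼 n` is the model Euclidean space `EuclideanSpace ℝ (Fin n)`. -/
local notation "𝔼 " n:arg => EuclideanSpace ℝ (Fin n)

/-- Local notation: `𝕊 n` is the unit sphere in `EuclideanSpace ℝ (Fin (n + 1))`, the standard
`n`-sphere with its Mathlib manifold structure. -/
local notation "𝕊 " n:arg => (Metric.sphere (0 : EuclideanSpace ℝ (Fin (n + 1))) 1)

namespace Knot

/-! ### The second knot as a loop in the complement of the first -/

/-- If the knots `K` and `J` have disjoint images, every point of `J` lies in the complement
`S³ ∖ K` of `K`. Rolfsen (1976), §5.D. [cite: Rolfsen1976] -/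
theorem mem_complement_of_disjoint {K J : Knot} (h : Disjoint (range ⇑K) (range ⇑J)) (x : 𝕊 1) :
    J x ∈ K.complement := by
  rw [SphereEmbedding.mem_complement_iff]
  exact fun hx ↦ Set.disjoint_left.1 h hx (mem_range_self x)

/-- The knot `J`, disjoint from `K`, as a **loop in the knot complement** `S³ ∖ K`:
`θ ↦ J (e^{2πiθ})`, `θ ∈ [0, 1]`, based at `J (circlePoint 0) = J (1, 0)`; it carries the
orientation of `J`. Rolfsen (1976), §5.D (2). [cite: Rolfsen1976] -/
def loopInCompl (K J : Knot) (h : Disjoint (range ⇑K) (range ⇑J)) :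
    Path (⟨J (circlePoint 0), mem_complement_of_disjoint h _⟩ : K.complement)
      ⟨J (circlePoint 0), mem_complement_of_disjoint h _⟩ where
  toFun θ := ⟨J (circlePoint (2 * Real.pi * θ)), mem_complement_of_disjoint h _⟩
  continuous_toFun := by
    refine Continuous.subtype_mk ?_ _
    exact J.isEmbedding.continuous.comp (continuous_circlePoint.comp (by fun_prop))
  source' := by
    apply Subtype.ext
    simp
  target' := by
    apply Subtype.ext
    simp only [Set.Icc.coe_one, mul_one]
    rw [← zero_add (2 * Real.pi), circlePoint_add_two_pi]

/-- The loop of `J` in `S³ ∖ K`, as a map to `𝕊 3`. [folklore] -/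
@[simp]
theorem coe_loopInCompl_apply (K J : Knot) (h : Disjoint (range ⇑K) (range ⇑J))
    (θ : unitInterval) : (K.loopInCompl J h θ : 𝕊 3) = J (circlePoint (2 * Real.pi * θ)) := rfl

/-! ### The linking number -/

/-- **Linking number** `lk(K, J) = l` of two disjoint oriented knots in `S³` (Rolfsen,
*Knots and Links* (1976), §5.D, definition (2)): the class `[J]` of the loop `J` in
`H₁(S³ ∖ K; ℤ) = π₁(S³ ∖ K)ᵃᵇ ≅ ℤ`, which is freely generated by the meridian of `K` (Alexander
duality), equals `l • [meridian]`. Concretely: there are an oriented tubular neighbourhood `ν`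
of `K` (whose meridian `ν.meridian` is oriented by `det_pos`) and a path `γ` in `S³ ∖ K` from
the base point `ν.basePoint` to `J (circlePoint 0)` such that the image in
`π₁(S³ ∖ K, ν.basePoint)ᵃᵇ` of the loop `γ · J · γ⁻¹` is the `l`-th power of the image of the
meridian. Since the target group is abelian, the choice of the conjugating path `γ` is
irrelevant, and the class of the meridian is independent of `ν`; hence `∃` may be replaced by
`∀` (`hasLinkingNumber_iff_forall`) and `l` is unique (`existsUnique_hasLinkingNumber`). This is
the exact pattern of `Literature.Topology.FourManifolds.Knot.TubularNbhd.HasFraming`. [folklore] -/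
def HasLinkingNumber (K J : Knot) (h : Disjoint (range ⇑K) (range ⇑J)) (l : ℤ) : Prop :=
  ∃ (ν : Knot.TubularNbhd K)
    (γ : Path ν.basePoint ⟨J (circlePoint 0), mem_complement_of_disjoint h _⟩),
    Abelianization.of (FundamentalGroup.fromPath
        (Path.Homotopic.Quotient.mk ((γ.trans (K.loopInCompl J h)).trans γ.symm))) =
      Abelianization.of (FundamentalGroup.fromPath (Path.Homotopic.Quotient.mk ν.meridian)) ^ l

/-- **The linking number does not depend on the choices**: in `HasLinkingNumber` the
existential quantifier over the tubular neighbourhood `ν` and the conjugating path `γ` may be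
replaced by a universal one. Independence of `γ`: two choices differ by conjugation by a loop,
invisible in the abelianisation. Independence of `ν`: any two oriented meridians of `K` are
homologous in `S³ ∖ K` (both are the positive generator of `H₁(S³ ∖ K) ≅ ℤ`, thanks to
`det_pos`), and a path between the base points induces the canonical identification of the
abelianised fundamental groups. Named fact (D-0014). Rolfsen (1976), §5.D, Thm 5.D.2;
Gompf–Stipsicz (1999), §4.5. [cite: Rolfsen1976, §5.D Thm 5.D.2] -/
def hasLinkingNumber_iff_forall : Prop :=
  ∀ (K J : Knot) (h : Disjoint (range ⇑K) (range ⇑J)) (l : ℤ),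
    K.HasLinkingNumber J h l ↔ ∀ (ν : Knot.TubularNbhd K)
      (γ : Path ν.basePoint ⟨J (circlePoint 0), mem_complement_of_disjoint h _⟩),
      Abelianization.of (FundamentalGroup.fromPath
          (Path.Homotopic.Quotient.mk ((γ.trans (K.loopInCompl J h)).trans γ.symm))) =
        Abelianization.of (FundamentalGroup.fromPath (Path.Homotopic.Quotient.mk ν.meridian)) ^ l

/-- **The linking number is well defined**: for disjoint knots `K`, `J` there is a unique
integer `l` with `lk(K, J) = l`, because `H₁(S³ ∖ K) ≅ ℤ` is freely generated by the meridian
(Alexander duality; Rolfsen (1976), §5.D Thm 5.D.2 with §3.B) and tubular neighbourhoods and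
connecting paths exist (`Knot.nonempty_tubularNbhd`; `S³ ∖ K` is path connected). Named fact
(D-0014). [cite: Rolfsen1976, §5.D Thm 5.D.2] -/
def existsUnique_hasLinkingNumber : Prop :=
  ∀ (K J : Knot) (h : Disjoint (range ⇑K) (range ⇑J)), ∃! l : ℤ, K.HasLinkingNumber J h l

/-! ### Symmetry and sign changes -/

section Reverse

variable [SphereEmbedding.SmoothnessFacts]

/-- The reverse of a knot has the same image. (Not a `simp` lemma: `simp` unfolds
`⇑J.reverse` via `SphereEmbedding.coe_reverse` first.) [folklore] -/
theorem range_reverse (J : Knot) : range ⇑J.reverse = range ⇑J := by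
  rw [SphereEmbedding.coe_reverse]
  exact (involutive_reflectLast 1).surjective.range_comp _

/-- The image of the mirror image of a knot is the reflection of its image. [folklore] -/
theorem range_mirror (K : Knot) : range ⇑K.mirror = reflectLast 3 '' range ⇑K := by
  rw [SphereEmbedding.coe_mirror, Set.range_comp]

/-- Knots disjoint from `K` stay disjoint after reversal. [folklore] -/
theorem disjoint_range_reverse {K J : Knot} (h : Disjoint (range ⇑K) (range ⇑J)) :
    Disjoint (range ⇑K) (range ⇑J.reverse) := by
  rwa [range_reverse]

/-- Disjoint knots have disjoint mirror images. [folklore] -/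
theorem disjoint_range_mirror {K J : Knot} (h : Disjoint (range ⇑K) (range ⇑J)) :
    Disjoint (range ⇑K.mirror) (range ⇑J.mirror) := by
  rw [range_mirror, range_mirror]
  exact (Set.disjoint_image_iff (involutive_reflectLast 3).injective).2 h

end Reverse

namespace HasLinkingNumber

/-- **Symmetry of the linking number**: `lk(K, J) = lk(J, K)`. Named fact (D-0014).
Rolfsen (1976), §5.D, Thm 5.D.1 (via the symmetric definitions (1), (3) of loc. cit.). [cite: Rolfsen1976, §5.D Thm 5.D.1] -/
protected def symm : Prop :=
  ∀ {K J : Knot} {h : Disjoint (range ⇑K) (range ⇑J)} {l : ℤ},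
    K.HasLinkingNumber J h l → J.HasLinkingNumber K h.symm l

/-- **Reversing one knot negates the linking number**: `lk(K, rJ) = -lk(K, J)` (the loop of
`rJ` is the inverse of the loop of `J` up to conjugation). Named fact (D-0014);
`[SphereEmbedding.SmoothnessFacts]` is the `Knots` instance hypothesis under which `Knot.reverse`
exists. Rolfsen (1976), §5.D (remark after Thm 5.D.1). [cite: Rolfsen1976, §5.D Thm 5.D.1] -/
def reverse_right [SphereEmbedding.SmoothnessFacts] : Prop :=
  ∀ {K J : Knot} {h : Disjoint (range ⇑K) (range ⇑J)} {l : ℤ},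
    K.HasLinkingNumber J h l → K.HasLinkingNumber J.reverse (disjoint_range_reverse h) (-l)

/-- **Mirror image negates the linking number**: `lk(K̄, J̄) = -lk(K, J)`, where both knots are
reflected by the same orientation-reversing reflection `reflectLast 3` of `S³` (which reverses
the `det_pos`-orientation of meridians). Named fact (D-0014); `[SphereEmbedding.SmoothnessFacts]`
is the `Knots` instance hypothesis under which `Knot.mirror` exists. Rolfsen (1976), §5.D
(remark after Thm 5.D.1), §3.C. [cite: Rolfsen1976, §5.D Thm 5.D.1] -/
protected def mirror [SphereEmbedding.SmoothnessFacts] : Prop :=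
  ∀ {K J : Knot} {h : Disjoint (range ⇑K) (range ⇑J)} {l : ℤ},
    K.HasLinkingNumber J h l → K.mirror.HasLinkingNumber J.mirror (disjoint_range_mirror h) (-l)

end HasLinkingNumber

/-! ### Bounding discs -/

/-- **A knot bounding a disc in the complement has linking number zero**: if `J` extends to a
continuous map of the closed unit disc `D² ⊆ ℝ²` into `S³ ∖ K` (in particular if `J` bounds a
smoothly embedded disc missing `K`), then `lk(K, J) = 0`, since the loop `J` is then
null-homotopic, hence null-homologous, in `S³ ∖ K`. Rolfsen (1976), §5.D (definition (2) and
Thm 5.D.2). The disc is a map `f : ℝ² → 𝕊 3`, continuous on `Metric.closedBall 0 1`, agreeing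
with `J` on the unit circle and missing `K` on the closed disc. Named fact (D-0014). [cite: Rolfsen1976, §5.D Thm 5.D.2] -/
def hasLinkingNumber_zero_of_exists_disc : Prop :=
  ∀ (K J : Knot) (h : Disjoint (range ⇑K) (range ⇑J)),
    (∃ f : 𝔼 2 → 𝕊 3, ContinuousOn f (Metric.closedBall 0 1) ∧
      (∀ u : 𝕊 1, f u = J u) ∧ ∀ x ∈ Metric.closedBall (0 : 𝔼 2) 1, f x ∉ range ⇑K) →
    K.HasLinkingNumber J h 0

end Knot

/-! ### Push-offs and framings as linking numbers -/

namespace Knot.TubularNbhd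

/-- The push-off `x ↦ ν (x, e₀)` of `K` along a tubular neighbourhood `ν` is a smooth embedding
`𝕊 1 → 𝕊 3`: it is the composition of the smooth embedding `ν : 𝕊 1 × ℝ² → 𝕊 3` with the
closed embedded slice `x ↦ (x, e₀)` (uses `Manifold.IsSmoothEmbedding.comp`, a Mathlib TODO).
This is the curve of G18's `ν.longitude` (`coe_longitude_apply`). Named fact (D-0014).
Hirsch (1976), §1.3; Rolfsen (1976), §9.F. [cite: Hirsch1976, §1.3] -/
def isSmoothEmbedding_pushOff : Prop :=
  ∀ {K : Knot} (ν : Knot.TubularNbhd K),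
    Manifold.IsSmoothEmbedding (𝓡 1) (𝓡 3) ∞ (fun x : 𝕊 1 ↦ ν (x, framingBaseVector))

/-- The named smoothness fact of this file whose proof is deferred (smoothness of the push-off,
`isSmoothEmbedding_pushOff`; it needs `Manifold.IsSmoothEmbedding.comp`, a Mathlib TODO), as a
`Prop`-valued class so that the construction `pushOff` and its lemmas consume it as one instance
hypothesis `[Knot.TubularNbhd.SmoothnessFacts]` (same pattern as
`SphereEmbedding.SmoothnessFacts` in `Knots`). Hirsch (1976), §1.3. [cite: Hirsch1976, §1.3] -/
class SmoothnessFacts : Prop where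
  /-- `isSmoothEmbedding_pushOff`. -/
  pushOff : isSmoothEmbedding_pushOff

variable {K : Knot} [SmoothnessFacts] (ν : Knot.TubularNbhd K)

/-- The **push-off** (longitude, framing curve, parallel) of the knot `K` along the oriented
tubular neighbourhood `ν`: the knot `x ↦ ν (x, e₀)`, `e₀ = framingBaseVector = (½, 0)`. Its
loop is G18's `ν.longitude`. Relies on: the named fact `isSmoothEmbedding_pushOff` (via
`[SmoothnessFacts]`). Rolfsen (1976), §5.D, §9.F; Gompf–Stipsicz (1999), §4.5. [cite: Rolfsen1976, §9.F] -/
def pushOff : Knot :=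
  ⟨fun x ↦ ν (x, framingBaseVector), SmoothnessFacts.pushOff ν⟩

/-- The push-off as a function. [folklore] -/
@[simp]
theorem pushOff_apply (x : 𝕊 1) : ν.pushOff x = ν (x, framingBaseVector) := rfl

/-- The push-off is disjoint from the knot (`ν (x, e₀) ∉ K (𝕊 1)` as `e₀ ≠ 0`,
`apply_mem_compl_range`). Rolfsen (1976), §9.F. [cite: Rolfsen1976] -/
theorem disjoint_range_pushOff : Disjoint (range ⇑K) (range ⇑ν.pushOff) := by
  refine Set.disjoint_right.2 ?_
  rintro _ ⟨x, rfl⟩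
  exact ν.apply_mem_compl_range framingBaseVector_ne_zero

/-- The base point of the loop of the push-off is the base point `ν.basePoint` of `ν`
(definitionally). [folklore] -/
theorem mk_pushOff_circlePoint_zero :
    (⟨ν.pushOff (circlePoint 0), mem_complement_of_disjoint ν.disjoint_range_pushOff _⟩ :
      K.complement) = ν.basePoint := rfl

/-- The loop of the push-off in `S³ ∖ K` is G18's longitude of `ν` (only the bookkeeping of
the base point differs, definitionally). [folklore] -/
theorem loopInCompl_pushOff :
    K.loopInCompl ν.pushOff ν.disjoint_range_pushOff = ν.longitude := by
  ext θ
  rfl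

/-- Conjugating the longitude by the constant path does not change its homotopy class. [folklore] -/
theorem mk_refl_trans_loopInCompl_pushOff_trans_refl_symm :
    Path.Homotopic.Quotient.mk (((Path.refl ν.basePoint).trans
        (K.loopInCompl ν.pushOff ν.disjoint_range_pushOff)).trans (Path.refl ν.basePoint).symm) =
      Path.Homotopic.Quotient.mk ν.longitude := by
  rw [Path.Homotopic.Quotient.eq, loopInCompl_pushOff, Path.refl_symm]
  exact (Path.Homotopic.trans_refl _).trans (Path.Homotopic.refl_trans _)

/-- **The framing is the linking number of the push-off**: `ν.HasFraming m` iff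
`lk(K, push-off of K along ν) = m`. The longitude of `ν` is literally the loop of the push-off
(`loopInCompl_pushOff`), so `→` is immediate with `γ` the constant path; `←` uses the
independence of the linking number from `(ν', γ)`, the named fact `hasLinkingNumber_iff_forall`
taken as the explicit hypothesis `hind`. Rolfsen (1976), §5.D, §9.F; Gompf–Stipsicz (1999),
§4.5. [cite: Rolfsen1976, §9.F] -/
theorem hasFraming_iff_hasLinkingNumber_pushOff (hind : hasLinkingNumber_iff_forall) (m : ℤ) :
    ν.HasFraming m ↔ K.HasLinkingNumber ν.pushOff ν.disjoint_range_pushOff m := by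
  constructor
  · intro hm
    refine ⟨ν, Path.refl ν.basePoint, ?_⟩
    exact (congrArg (fun p ↦ Abelianization.of (FundamentalGroup.fromPath p))
      ν.mk_refl_trans_loopInCompl_pushOff_trans_refl_symm).trans hm
  · intro hl
    have := (hind K ν.pushOff ν.disjoint_range_pushOff m).1 hl ν
      (Path.refl ν.basePoint)
    exact (congrArg (fun p ↦ Abelianization.of (FundamentalGroup.fromPath p))
      ν.mk_refl_trans_loopInCompl_pushOff_trans_refl_symm).symm.trans this

end Knot.TubularNbhd

end Literature.Topology.FourManifolds
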